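import Literature.MathematicalPhysics.QuantumFieldTheory.BalabanImbrieJaffe1984to88.BIJ88SDerivativesAllOrders305
import Literature.MathematicalPhysics.QuantumFieldTheory.BalabanImbrieJaffe1984to88.BIJ88PolymerRep5134Deriv
import Literature.MathematicalPhysics.QuantumFieldTheory.BalabanImbrieJaffe1984to88.BIJ88PolymerRep5134Gauss
import Mathlib.Analysis.Calculus.BumpFunction.FiniteDimension
import Mathlib.Analysis.Calculus.FDeriv.Symmetric

/-!
# `BalabanImbrieJaffe1984to88.BIJ88PolymerRep5134DerivGauss` — T. Bałaban, J. Imbrie, A. Jaffe, *Effective action and cluster properties of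
the abelian Higgs model*, Commun. Math. Phys. **114** (1988) 257–315 [BalabanImbrieJaffe1988], §5.13 pp. 305–306 [PDF 49–50]: **display
(5.13.4), left equality, WITH THE PRINTED DERIVATIVE-FORM ACTIVITIES `g₁(X) = Σ_Γ ∫ds_Γ (∂/∂s_Γ)⟨Π_{□_i⊂X} f(□_i)⟩_{s_Γ,X}`, FOR THE
GAUSSIAN MEASURES OF §5.13, UNCONDITIONALLY** — the smoothness hypotheses of `BIJ88PolymerRep5134Deriv.polymerRep_deriv` (p02's FTC
expansion `BIJ88FTCExpansion305.ftc_expansion`: continuous mixed partials along all coordinate lines of `ℝ^I`) are DISCHARGED for the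
expectations `⟨Π_{□_i⊂X} f(□_i)⟩_{s,X}` of `BIJ88PolymerRep5134Gauss` (`Δ ≻ 0`, cube-local bounded measurable `f(□_i)`, any `ℱ`), using the
all-orders smoothness of Gaussian integrals in the precision (`BIJ88SDerivativesAllOrders305`).

statement-level skeleton of published theorems with citation tags; proofs where landed; nothing here is a claim about the Yang–Mills mass gap

PDF held: `paper:balaban1988-cmp114-bij-abelian-higgs-effective-action` (journal page = PDF page + 256); pp. 305–306 = PDF 49–50 rendered and
read as images this session (p25 seat `renders/original-p049-x2.png`, `…p050-x2.png`).

**The print (verbatim).** p. 305: *"To give our expansion, we use the fundamental theorem of calculus to write ⟨Π_{i∈I} f(□_i)⟩_1 =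
Σ_{Γ⊂I} ∫ds_Γ (∂/∂s_Γ)⟨Π_{i∈I} f(□_i)⟩_{s_Γ}. Here s_Γ specifies s_i = 0 for i ∉ Γ, ds_Γ = Π_{i∈Γ} ds_i, ∂/∂s_Γ = Π_{i∈Γ} d/ds_i, and
⟨·⟩_{s_Γ} is the expectation with quadratic form Δ_{s_Γ} instead of Δ."*; p. 306: *"Given some region X, a union of □_i, we sum Γ over all
subsets of {i ∈ I : □_i ⊂ X}, such that X is a single cluster. … g₁(X) = Σ_Γ ∫ds_Γ Σ_{π∈𝒫(Γ)} ⟨…⟩_{s_Γ,X}. Here s = {s_i : □_i ⊂ X}, and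
⟨·⟩_{s_Γ,X} is defined by integrating over the fields in X only. … Σ_{{X_α} filling Λ^{(k)}_{10}} Π_α g₁(X_α) (5.13.4)"*.

**What is proved (0 `sorry`, standard axioms, 0 new `Prop` facts).**
* §1 (generic `ι`) `pd l G` — the iterated partial `∂_{k₁}⋯∂_{k_m}G` along a list (`∂_kG(s) = DG(s)e_k`): `pd_append`, `contDiff_pd`,
  **`dir_comm`** (partials of a `C^∞` function commute: `ContDiffAt.isSymmSndFDerivAt`), **`pd_dir_comm`**, `hasDerivAt_update_of_contDiff`
  (the derivative along the coordinate line `u ↦ s[k↦u]` is `∂_k`), `pd_eventuallyEq` (germ dependence), **`iterInt_congr_cube`** (p02's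
  `∫ds_Γ` sees only the unit cube), `filter_insert_split` (the `L`-ordered list of `Γ ∪ {k}` is `l₁ ++ k :: l₂`).
* §2 the smooth squash `psi`/`Psi` of `ℝ^I` into the `δ`-box around the cube, equal to the identity on the `δ/2`-box (`ContDiffBump`):
  `contDiff_Psi`, `Psi_eq_self`, `Psi_mem`, `Psi_eventuallyEq_id`.
* §3 the model of `BIJ88PolymerRep5134Gauss` (`blk`, `Δ`, `ℱ`, `f`): `precE` (entries of `prec X s`, `contDiff_precE` — polynomial in `s`),
  `num`/`den`/`expect_eq_num_div_den`, `good X = precE X ⁻¹' coerciveSet` (`isOpen_good`; `cube_subset_good` for `Δ ≻ 0` via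
  `interpForm_posDef`), `obs_measurable`, `obs_bdd`, **`contDiffOn_expect`**: `s ↦ ⟨Π_{□_i⊂X} f(□_i)⟩_{s,X}` is `C^∞` on `good X`;
  `exists_box_subset_good(_all)`: a `δ`-box around the cube inside `good X` (`IsCompact.exists_cthickening_subset_open`).
* §4 `expectSq` (`= expect ∘ Ψ`, `C^∞` on `ℝ^I`: `contDiff_expectSq`), the family **`Dsq X Γ := pd (L.filter (· ∈ Γ)) expectSq`** with
  p02's hypotheses **`continuous_Dsq`**, **`hasDerivAt_Dsq`** (`∂_k D X Γ = D X (Γ∪{k})` along coordinate lines — commuting partials) and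
  corner values `Dsq_empty_corner` (`= zG X Λ`); the honest family **`Dexp X Γ := pd (L.filter (· ∈ Γ)) expect`** (`Dexp_empty`),
  `Dsq_eventuallyEq_Dexp`, `Dsq_eq_Dexp_of_mem_cube`, **`hasDerivAt_Dexp`** (the honest partials satisfy the FTC recursion
  `d/du ∂_Γ⟨…⟩_{s[k↦u]} = ∂_{Γ∪{k}}⟨…⟩_s` at every point of the CLOSED cube, two-sidedly); **`ftc_expansion_gauss`** — the p. 305 FTC
  display `⟨Π_{□_i⊂X} f(□_i)⟩_{1,X} = Σ_{Γ⊂I} ∫ds_Γ ∂_Γ⟨Π_{□_i⊂X} f(□_i)⟩_{s_Γ,X}` for the Gaussian expectations, p02's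
  `ftc_expansion_univ` with its hypotheses discharged; `g1Deriv_Dsq_eq`; **`polymerRep_deriv_gauss`**, **`polymerRep_deriv_gauss_univ`**:
  `⟨Π_{i∈W} f(□_i)⟩_{1_W,W} = Σ_{P ∈ setPartitions W, IsAdmissible} Π_{X∈P} g1Deriv adj L Dexp X`, i.e. (5.13.4) left equality with
  `g₁(X) = Σ_{Γ⊆X, X single cluster} ∫ds_Γ ∂_Γ⟨Π_{□_i⊂X}f(□_i)⟩_{s_Γ,X}`, the `∂_Γ` honest iterated Fréchet partials of the Gaussian
  expectation and `∫ds_Γ` p02's iterated unit-interval integrals.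

**Honest scope.** As `BIJ88PolymerRep5134Gauss`: one finite-dimensional real Gaussian per region, no constraint `δ_{Ax}`; `f(□_i)` bounded
measurable and cube-local; `Δ ≻ 0` with `Δ_{xy} = 0` between distinct non-abutting cubes. The walk/pairing expansion (5.13.3) of the
derivative and the Mayer sets are not reproduced (p13's `BIJ88TruncatedPair306`, gen-7 `BIJ88Resummation5141`); fillings are the ADMISSIBLE
ones (reading note GAPS.md G-C2-p25-03). NOT summit progress; NOT continuum; NOT Clay. Imports: `BIJ88SDerivativesAllOrders305`,
`BIJ88PolymerRep5134Deriv`, `BIJ88PolymerRep5134Gauss`, Mathlib bump functions / symmetric second derivative; modifies nothing. Cell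
`lit-balaban` Phase 2, seat p25 gen 8; row C2.Eq5.13.3-5.13.4 (owner r16, referee ref-5).
-/

noncomputable section

namespace Literature.MathematicalPhysics.QuantumFieldTheory.BalabanImbrieJaffe1984to88.BIJ88PolymerRep5134DerivGauss

open MeasureTheory Matrix Finset Filter Function Metric Set
open scoped BigOperators Topology ContDiff
open Literature.Probability.LatticeModels (IsSetPartition setPartitions mem_setPartitions)
open Literature.MathematicalPhysics.QuantumFieldTheory.Balaban1983to89
open B2Eq228Conditioning (weight source)
open BIJ88DirichletForms305 (interpForm interpForm_apply interpForm_posDef)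
open BIJ88FTCExpansion305 (iterInt expansionSum ftc_expansion_univ)
open BIJ88SDerivative305 (update_mem_cube)
open BIJ88SDerivativesAllOrders305
open BIJ88Clusters5134 BIJ88PolymerRep5134 BIJ88PolymerRep5134Gauss BIJ88PolymerRep5134Deriv

/-! ## §1 Iterated partial derivatives along a list of coordinates -/

section PD

variable {ι : Type} [Fintype ι] [DecidableEq ι]

/-- `∂_{k₁}∂_{k₂}⋯∂_{k_m} G` for the list `[k₁,…,k_m]` (outermost derivative first; `∂_k G(s) = DG(s)·e_k`).
[cite: BalabanImbrieJaffe1988, (5.13.3) p.305] -/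
def pd : List ι → ((ι → ℝ) → ℝ) → (ι → ℝ) → ℝ
  | [], G => G
  | k :: l, G => fun s => fderiv ℝ (pd l G) s (Pi.single k 1)

omit [Fintype ι] in
/-- no derivative. [cite: BalabanImbrieJaffe1988, (5.13.3) p.305] -/
@[simp] theorem pd_nil (G : (ι → ℝ) → ℝ) : pd [] G = G := rfl

omit [Fintype ι] in
/-- one more derivative. [cite: BalabanImbrieJaffe1988, (5.13.3) p.305] -/
theorem pd_cons (k : ι) (l : List ι) (G : (ι → ℝ) → ℝ) : pd (k :: l) G = fun s => fderiv ℝ (pd l G) s (Pi.single k 1) := rfl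

omit [Fintype ι] in
/-- concatenation = composition. [cite: BalabanImbrieJaffe1988, (5.13.3) p.305] -/
theorem pd_append (l₁ l₂ : List ι) (G : (ι → ℝ) → ℝ) : pd (l₁ ++ l₂) G = pd l₁ (pd l₂ G) := by
  induction l₁ with
  | nil => rfl
  | cons k l₁ ih => simp only [List.cons_append, pd_cons, ih]

omit [DecidableEq ι] in
/-- a directional derivative of a smooth function is smooth. [cite: BalabanImbrieJaffe1988, (5.13.3) p.305] -/
theorem contDiff_dir {G : (ι → ℝ) → ℝ} (hG : ContDiff ℝ ∞ G) (v : ι → ℝ) : ContDiff ℝ ∞ fun s => fderiv ℝ G s v :=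
  (contDiff_infty_iff_fderiv.1 hG).2.clm_apply contDiff_const

/-- iterated partials of a smooth function are smooth. [cite: BalabanImbrieJaffe1988, (5.13.3) p.305] -/
theorem contDiff_pd {G : (ι → ℝ) → ℝ} (hG : ContDiff ℝ ∞ G) : ∀ l : List ι, ContDiff ℝ ∞ (pd l G)
  | [] => hG
  | _ :: l => contDiff_dir (contDiff_pd hG l) _

omit [DecidableEq ι] in
/-- **directional derivatives of a smooth function commute** (symmetry of the second derivative).
[cite: BalabanImbrieJaffe1988, (5.13.3) p.305] -/
theorem dir_comm {G : (ι → ℝ) → ℝ} (hG : ContDiff ℝ ∞ G) (v w s : ι → ℝ) :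
    fderiv ℝ (fun s => fderiv ℝ G s v) s w = fderiv ℝ (fun s => fderiv ℝ G s w) s v := by
  have hd : DifferentiableAt ℝ (fderiv ℝ G) s :=
    ((contDiff_infty_iff_fderiv.1 hG).2.differentiable (by simp)).differentiableAt
  have h : ∀ u : ι → ℝ, fderiv ℝ (fun s => fderiv ℝ G s u) s = (fderiv ℝ (fderiv ℝ G) s).flip u := by
    intro u
    rw [fderiv_clm_apply hd (differentiableAt_const u)]
    simp
  rw [h v, h w, ContinuousLinearMap.flip_apply, ContinuousLinearMap.flip_apply]
  have h2 : minSmoothness ℝ 2 ≤ (∞ : WithTop ℕ∞) := by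
    rw [minSmoothness_of_isRCLikeNormedField]
    exact WithTop.coe_le_coe.2 le_top
  exact hG.contDiffAt.isSymmSndFDerivAt h2 w v

/-- a directional derivative commutes with the iterated partials. [cite: BalabanImbrieJaffe1988, (5.13.3) p.305] -/
theorem pd_dir_comm {G : (ι → ℝ) → ℝ} (hG : ContDiff ℝ ∞ G) (v : ι → ℝ) :
    ∀ l : List ι, pd l (fun s => fderiv ℝ G s v) = fun s => fderiv ℝ (pd l G) s v
  | [] => rfl
  | k :: l => by
      funext s
      simp only [pd_cons]
      rw [pd_dir_comm hG v l]
      exact dir_comm (contDiff_pd hG l) v (Pi.single k 1) s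

/-- the derivative along a coordinate line of a smooth function. [cite: BalabanImbrieJaffe1988, (5.13.3) p.305] -/
theorem hasDerivAt_update_of_contDiff {G : (ι → ℝ) → ℝ} (hG : ContDiff ℝ ∞ G) (s : ι → ℝ) (k : ι) :
    HasDerivAt (fun u => G (update s k u)) (fderiv ℝ G s (Pi.single k 1)) (s k) := by
  have h2 := hasDerivAt_update s k (s k)
  have h1 : HasFDerivAt G (fderiv ℝ G s) (update s k (s k)) := by
    rw [update_eq_self]
    exact ((hG.differentiable (by simp)).differentiableAt).hasFDerivAt
  exact h1.comp_hasDerivAt (s k) h2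

omit [Fintype ι] in
/-- iterated partials depend only on the germ. [cite: BalabanImbrieJaffe1988, (5.13.3) p.305] -/
theorem pd_eventuallyEq {G₁ G₂ : (ι → ℝ) → ℝ} : ∀ (l : List ι) {s : ι → ℝ}, G₁ =ᶠ[𝓝 s] G₂ → pd l G₁ =ᶠ[𝓝 s] pd l G₂
  | [], _, h => h
  | k :: l, _, h => by
      have ih : ∀ᶠ s' in 𝓝 _, pd l G₁ =ᶠ[𝓝 s'] pd l G₂ :=
        (eventually_eventually_nhds.2 h).mono fun s' hs' => pd_eventuallyEq l hs'
      simp only [pd_cons]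
      exact ih.mono fun s' hs' => by
        dsimp only
        rw [hs'.fderiv_eq]

omit [Fintype ι] in
/-- the iterated unit-interval integrals of p02 see only the values on the unit cube. [cite: BalabanImbrieJaffe1988, (5.13.3) p.305] -/
theorem iterInt_congr_cube {g₁ g₂ : (ι → ℝ) → ℝ} (h : ∀ σ : ι → ℝ, (∀ i, 0 ≤ σ i ∧ σ i ≤ 1) → g₁ σ = g₂ σ) :
    ∀ (l : List ι) (σ : ι → ℝ), (∀ i, 0 ≤ σ i ∧ σ i ≤ 1) → iterInt l g₁ σ = iterInt l g₂ σ
  | [], σ, hσ => h σ hσ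
  | k :: l, σ, hσ => by
      simp only [iterInt]
      refine intervalIntegral.integral_congr fun t ht => ?_
      rw [Set.uIcc_of_le zero_le_one] at ht
      exact iterInt_congr_cube h l _ (update_mem_cube hσ k ⟨ht.1, ht.2⟩)

omit [Fintype ι] in
/-- p02's `Σ_Γ ∫ds_Γ D_Γ` sees only the values of the `D_Γ` on the unit cube. [cite: BalabanImbrieJaffe1988, (5.13.3) p.305] -/
theorem expansionSum_congr_cube {D₁ D₂ : Finset ι → (ι → ℝ) → ℝ}
    (h : ∀ (Γ : Finset ι) (σ : ι → ℝ), (∀ i, 0 ≤ σ i ∧ σ i ≤ 1) → D₁ Γ σ = D₂ Γ σ) (l : List ι) {σ : ι → ℝ}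
    (hσ : ∀ i, 0 ≤ σ i ∧ σ i ≤ 1) : expansionSum l D₁ σ = expansionSum l D₂ σ := by
  unfold expansionSum
  congr 1
  refine List.map_congr_left fun Γ _ => ?_
  exact iterInt_congr_cube (h Γ.toFinset) Γ σ hσ

omit [Fintype ι] in
/-- **inserting a coordinate into the filtered list**: for `k ∈ L ∖ Γ` (no duplicates in `L`) the `L`-ordered list of `insert k Γ` is
`l₁ ++ k :: l₂` with `l₁ ++ l₂` the list of `Γ`. [cite: BalabanImbrieJaffe1988, (5.13.3) p.305] -/
theorem filter_insert_split {L : List ι} (hL : L.Nodup) {k : ι} (hk : k ∈ L) {Γ : Finset ι} (hkΓ : k ∉ Γ) :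
    ∃ l₁ l₂ : List ι, L.filter (· ∈ insert k Γ) = l₁ ++ k :: l₂ ∧ L.filter (· ∈ Γ) = l₁ ++ l₂ := by
  obtain ⟨L₁, L₂, rfl⟩ := List.append_of_mem hk
  have hkk : ¬ List.Sublist [k, k] (L₁ ++ k :: L₂) := List.nodup_iff_sublist.1 hL k
  have hk1 : k ∉ L₁ := by
    intro h
    apply hkk
    have h1 : List.Sublist [k] L₁ := List.singleton_sublist.2 h
    have h2 : List.Sublist [k] (k :: L₂) := List.singleton_sublist.2 List.mem_cons_self
    exact h1.append h2
  have hk2 : k ∉ L₂ := by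
    intro h
    apply hkk
    have h2 : List.Sublist [k, k] (k :: L₂) := (List.singleton_sublist.2 h).cons_cons k
    exact h2.trans (List.sublist_append_right L₁ (k :: L₂))
  have e1 : L₁.filter (· ∈ insert k Γ) = L₁.filter (· ∈ Γ) :=
    List.filter_congr fun x hx => by
      have hxk : x ≠ k := fun h => hk1 (h ▸ hx)
      simp [Finset.mem_insert, hxk]
  have e2 : L₂.filter (· ∈ insert k Γ) = L₂.filter (· ∈ Γ) :=
    List.filter_congr fun x hx => by
      have hxk : x ≠ k := fun h => hk2 (h ▸ hx)
      simp [Finset.mem_insert, hxk]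
  refine ⟨L₁.filter (· ∈ Γ), L₂.filter (· ∈ Γ), ?_, ?_⟩
  · rw [List.filter_append, List.filter_cons, e1, e2]
    simp
  · rw [List.filter_append, List.filter_cons]
    simp [hkΓ]

end PD

/-! ## §2 A smooth squash of `ℝ` onto a neighbourhood of `[0,1]`, equal to the identity near `[0,1]` -/

section Squash

variable {δ : ℝ}

/-- the bump `χ` centred at `½`: `1` on `[−δ/2, 1+δ/2]`, `0` off `(−δ, 1+δ)`. [cite: BalabanImbrieJaffe1988, (5.13.3) p.305] -/
def bump (hδ : 0 < δ) : ContDiffBump (1/2 : ℝ) := ⟨1/2 + δ/2, 1/2 + δ, by positivity, by linarith⟩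

/-- the squash `ψ(u) = ½ + χ(u)(u − ½)`. [cite: BalabanImbrieJaffe1988, (5.13.3) p.305] -/
def psi (hδ : 0 < δ) (u : ℝ) : ℝ := 1/2 + bump hδ u * (u - 1/2)

/-- `ψ` is smooth. [cite: BalabanImbrieJaffe1988, (5.13.3) p.305] -/
theorem contDiff_psi (hδ : 0 < δ) : ContDiff ℝ ∞ (psi hδ) :=
  contDiff_const.add ((bump hδ).contDiff.mul (contDiff_id.sub contDiff_const))

/-- `ψ = id` on `[−δ/2, 1+δ/2]`. [cite: BalabanImbrieJaffe1988, (5.13.3) p.305] -/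
theorem psi_eq_self (hδ : 0 < δ) {u : ℝ} (hu : -(δ/2) ≤ u ∧ u ≤ 1 + δ/2) : psi hδ u = u := by
  have h1 : bump hδ u = 1 := by
    apply (bump hδ).one_of_mem_closedBall
    rw [mem_closedBall, Real.dist_eq, abs_le]
    simp only [bump]
    constructor <;> linarith [hu.1, hu.2]
  rw [psi, h1]
  ring

/-- `ψ` takes values in `[−δ, 1+δ]`. [cite: BalabanImbrieJaffe1988, (5.13.3) p.305] -/
theorem psi_mem (hδ : 0 < δ) (u : ℝ) : -δ ≤ psi hδ u ∧ psi hδ u ≤ 1 + δ := by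
  have h0 := (bump hδ).nonneg (x := u)
  have h1 := (bump hδ).le_one (x := u)
  by_cases hfar : (bump hδ).rOut ≤ dist u (1/2 : ℝ)
  · have hz : bump hδ u = 0 := (bump hδ).zero_of_le_dist hfar
    rw [psi, hz]
    constructor <;> linarith
  · push Not at hfar
    rw [Real.dist_eq, abs_lt] at hfar
    simp only [bump] at hfar
    rw [psi]
    have : |bump hδ u * (u - 1/2)| ≤ |u - 1/2| := by
      rw [abs_mul, abs_of_nonneg h0]
      exact mul_le_of_le_one_left (abs_nonneg _) h1
    rw [abs_le] at this
    have hu := abs_lt.2 ⟨hfar.1, hfar.2⟩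
    rw [abs_lt] at hu
    constructor <;> nlinarith [this.1, this.2, hu.1, hu.2, abs_nonneg (u - 1/2), le_abs_self (u - 1/2), neg_abs_le (u - 1/2)]

variable {ι : Type} [Fintype ι]

/-- the coordinatewise squash `Ψ(s)_i = ψ(s_i)`. [cite: BalabanImbrieJaffe1988, (5.13.3) p.305] -/
def Psi (hδ : 0 < δ) (s : ι → ℝ) : ι → ℝ := fun i => psi hδ (s i)

/-- `Ψ` is smooth. [cite: BalabanImbrieJaffe1988, (5.13.3) p.305] -/
theorem contDiff_Psi (hδ : 0 < δ) : ContDiff ℝ ∞ (Psi (ι := ι) hδ) :=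
  contDiff_pi.2 fun i => (contDiff_psi hδ).comp (contDiff_apply ℝ ℝ i)

omit [Fintype ι] in
/-- `Ψ = id` on the closed `δ/2`-box around the cube. [cite: BalabanImbrieJaffe1988, (5.13.3) p.305] -/
theorem Psi_eq_self (hδ : 0 < δ) {s : ι → ℝ} (hs : ∀ i, -(δ/2) ≤ s i ∧ s i ≤ 1 + δ/2) : Psi hδ s = s :=
  funext fun i => psi_eq_self hδ (hs i)

omit [Fintype ι] in
/-- `Ψ` maps into the closed `δ`-box. [cite: BalabanImbrieJaffe1988, (5.13.3) p.305] -/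
theorem Psi_mem (hδ : 0 < δ) (s : ι → ℝ) (i : ι) : -δ ≤ Psi hδ s i ∧ Psi hδ s i ≤ 1 + δ := psi_mem hδ (s i)

/-- near a point of the open `δ/2`-box, `Ψ` is the identity. [cite: BalabanImbrieJaffe1988, (5.13.3) p.305] -/
theorem Psi_eventuallyEq_id (hδ : 0 < δ) {s : ι → ℝ} (hs : ∀ i, -(δ/2) < s i ∧ s i < 1 + δ/2) :
    ∀ᶠ s' in 𝓝 s, Psi hδ s' = s' := by
  have hopen : IsOpen (Set.pi Set.univ fun _ : ι => Set.Ioo (-(δ/2)) (1 + δ/2)) :=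
    isOpen_set_pi Set.finite_univ fun _ _ => isOpen_Ioo
  have hmem : s ∈ Set.pi Set.univ fun _ : ι => Set.Ioo (-(δ/2)) (1 + δ/2) := fun i _ => hs i
  filter_upwards [hopen.mem_nhds hmem] with s' hs'
  exact Psi_eq_self hδ fun i => ⟨(hs' i (Set.mem_univ i)).1.le, (hs' i (Set.mem_univ i)).2.le⟩

end Squash

/-! ## §3 The Gaussian expectations `⟨Π_{□_i⊂X} f(□_i)⟩_{s,X}` are smooth in `s` near the cube -/

section Model

variable {α I : Type} [Fintype α] [DecidableEq α] [Fintype I] [DecidableEq I]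
  (blk : α → I) (Δ : Matrix α α ℝ) (ℱ : α → ℝ) (f : I → (α → ℝ) → ℝ)

/-- the precision entries of the `X`-marginal as a function of the parameters. [cite: BalabanImbrieJaffe1988, p.305 (Sect. 5.13)] -/
def precE (X : Finset I) (s : I → ℝ) : BIJ88PolymerRep5134Gauss.Site blk X → BIJ88PolymerRep5134Gauss.Site blk X → ℝ :=
  fun x y => prec blk Δ X s x y

/-- `Matrix.of (precE X s) = prec X s`. [cite: BalabanImbrieJaffe1988, p.305 (Sect. 5.13)] -/
theorem of_precE (X : Finset I) (s : I → ℝ) : Matrix.of (precE blk Δ X s) = prec blk Δ X s := by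
  ext x y
  rfl

/-- the entries are polynomial, hence smooth, in `s` (`interpForm_apply`). [cite: BalabanImbrieJaffe1988, p.305 (Sect. 5.13)] -/
theorem contDiff_precE (X : Finset I) : ContDiff ℝ ∞ (precE blk Δ X) := by
  refine contDiff_pi.2 fun x => contDiff_pi.2 fun y => ?_
  have h : (fun s : I → ℝ => precE blk Δ X s x y)
      = fun s => if blk x.1 = blk y.1 then Δ x.1 y.1 else s (blk x.1) * s (blk y.1) * Δ x.1 y.1 := by
    funext s
    simp only [precE, prec, submatrix_apply, interpForm_apply]
  rw [h]
  split_ifs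
  · exact contDiff_const
  · exact ((contDiff_apply ℝ ℝ (blk x.1)).mul (contDiff_apply ℝ ℝ (blk y.1))).mul contDiff_const

/-- the numerator `∫ Π f · e^{−½⟨φ,prec φ⟩} e^{⟨ℱ,φ⟩}`. [cite: BalabanImbrieJaffe1988, p.306 (Sect. 5.13)] -/
def num (X : Finset I) (s : I → ℝ) : ℝ := gaussInt (src blk ℱ X) (obs blk f X) (precE blk Δ X s)

/-- the partition function `∫ e^{−½⟨φ,prec φ⟩} e^{⟨ℱ,φ⟩}`. [cite: BalabanImbrieJaffe1988, p.306 (Sect. 5.13)] -/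
def den (X : Finset I) (s : I → ℝ) : ℝ := gaussInt (src blk ℱ X) (fun _ => 1) (precE blk Δ X s)

/-- `⟨Π f⟩_{s,X} = num/den`. [cite: BalabanImbrieJaffe1988, p.306 (Sect. 5.13)] -/
theorem expect_eq_num_div_den (X : Finset I) (s : I → ℝ) :
    BIJ88PolymerRep5134Gauss.expect blk Δ ℱ f X s = num blk Δ ℱ f X s / den blk Δ ℱ X s := by
  rw [BIJ88PolymerRep5134Gauss.expect, num, den, gaussInt, gaussInt, of_precE]
  congr 1
  exact integral_congr_ae (Eventually.of_forall fun φ => (one_mul _).symm)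

/-- the set of parameters at which the `X`-precision is coercive (open, contains the cube for `Δ ≻ 0`).
[cite: BalabanImbrieJaffe1988, p.305 (Sect. 5.13)] -/
def good (X : Finset I) : Set (I → ℝ) := precE blk Δ X ⁻¹' coerciveSet

/-- `good X` is open. [cite: BalabanImbrieJaffe1988, p.305 (Sect. 5.13)] -/
theorem isOpen_good (X : Finset I) : IsOpen (good blk Δ X) :=
  isOpen_coerciveSet.preimage (contDiff_precE blk Δ X).continuous

/-- for `Δ ≻ 0` the unit cube lies in `good X` (*"To preserve positivity"*, `interpForm_posDef`). [cite: BalabanImbrieJaffe1988, p.305 (Sect. 5.13)] -/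
theorem cube_subset_good (hΔ : Δ.PosDef) (X : Finset I) {s : I → ℝ} (hs : ∀ i, 0 ≤ s i ∧ s i ≤ 1) : s ∈ good blk Δ X := by
  have hP : (prec blk Δ X s).PosDef := (interpForm_posDef blk hΔ hs).submatrix Subtype.val_injective
  have := mem_coerciveSet_of_posDef hP
  rwa [← of_precE, Equiv.symm_apply_apply] at this

variable {f}

omit [DecidableEq α] [Fintype I] in
/-- the observable `Π_{i∈X} f i ∘ ext` is measurable and bounded when the `f i` are. [cite: BalabanImbrieJaffe1988, p.306 (Sect. 5.13)] -/
theorem obs_measurable (hfm : ∀ i, Measurable (f i)) (X : Finset I) : Measurable (obs blk f X) := by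
  have hext : Continuous (BIJ88PolymerRep5134Gauss.ext blk X) := by
    refine continuous_pi fun x => ?_
    by_cases h : blk x ∈ X
    · simp only [BIJ88PolymerRep5134Gauss.ext, dif_pos h]
      exact continuous_apply _
    · simp only [BIJ88PolymerRep5134Gauss.ext, dif_neg h]
      exact continuous_const
  refine Finset.measurable_prod _ fun i _ => (hfm i).comp hext.measurable

omit [Fintype α] [DecidableEq α] [Fintype I] in
/-- bound of the observable. [cite: BalabanImbrieJaffe1988, p.306 (Sect. 5.13)] -/
theorem obs_bdd (hfb : ∀ i, ∃ K, ∀ φ, |f i φ| ≤ K) (X : Finset I) : ∃ K, ∀ φ, ‖obs blk f X φ‖ ≤ K := by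
  choose K hK using hfb
  refine ⟨∏ i ∈ X, K i, fun φ => ?_⟩
  rw [obs, Real.norm_eq_abs, Finset.abs_prod]
  exact Finset.prod_le_prod (fun i _ => abs_nonneg _) fun i _ => hK i _

variable (f)

/-- **the numerator, the partition function and the expectation are `C^∞` in `s` on `good X`.**
[cite: BalabanImbrieJaffe1988, p.305 (Sect. 5.13)] -/
theorem contDiffOn_expect (hfm : ∀ i, Measurable (f i)) (hfb : ∀ i, ∃ K, ∀ φ, |f i φ| ≤ K) (X : Finset I) :
    ContDiffOn ℝ ∞ (BIJ88PolymerRep5134Gauss.expect blk Δ ℱ f X) (good blk Δ X) := by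
  obtain ⟨K, hK⟩ := obs_bdd blk hfb X
  have hN : ContDiffOn ℝ ∞ (num blk Δ ℱ f X) (good blk Δ X) :=
    (contDiffOn_gaussInt (src blk ℱ X) (obs_measurable blk hfm X).aestronglyMeasurable hK).comp
      (contDiff_precE blk Δ X).contDiffOn fun s hs => hs
  have hD : ContDiffOn ℝ ∞ (den blk Δ ℱ X) (good blk Δ X) :=
    (contDiffOn_gaussInt (src blk ℱ X) (G := fun _ => (1:ℝ)) aestronglyMeasurable_const (K₀ := 1)
      (fun _ => by simp)).comp (contDiff_precE blk Δ X).contDiffOn fun s hs => hs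
  have hD0 : ∀ s ∈ good blk Δ X, den blk Δ ℱ X s ≠ 0 := by
    rintro s ⟨c, hc, hcM⟩
    exact (gaussInt_one_pos hc hcM (src blk ℱ X)).ne'
  have h := hN.div hD hD0
  refine h.congr fun s _ => expect_eq_num_div_den blk Δ ℱ f X s

/-- **a `δ`-box around the cube inside `good X`** (compactness of the cube, openness of `good X`).
[cite: BalabanImbrieJaffe1988, p.305 (Sect. 5.13)] -/
theorem exists_box_subset_good (hΔ : Δ.PosDef) (X : Finset I) :
    ∃ δ : ℝ, 0 < δ ∧ ∀ s : I → ℝ, (∀ i, -δ ≤ s i ∧ s i ≤ 1 + δ) → s ∈ good blk Δ X := by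
  have hK : IsCompact (Set.Icc (0 : I → ℝ) 1) := isCompact_Icc
  have hKU : Set.Icc (0 : I → ℝ) 1 ⊆ good blk Δ X := fun s hs => cube_subset_good blk Δ hΔ X fun i => ⟨hs.1 i, hs.2 i⟩
  obtain ⟨δ, hδ, hsub⟩ := hK.exists_cthickening_subset_open (isOpen_good blk Δ X) hKU
  refine ⟨δ, hδ, fun s hs => hsub ?_⟩
  -- `s` is within `δ` of its clamp into the cube
  set k : I → ℝ := fun i => max 0 (min 1 (s i)) with hk
  have hkK : k ∈ Set.Icc (0 : I → ℝ) 1 := ⟨fun i => le_max_left _ _, fun i => max_le zero_le_one (min_le_left _ _)⟩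
  refine Metric.mem_cthickening_of_dist_le s k δ _ hkK ?_
  rw [dist_pi_le_iff hδ.le]
  intro i
  rw [Real.dist_eq, abs_le]
  have h1 := hs i
  constructor
  · simp only [hk]
    rcases le_total 0 (s i) with h | h
    · rw [max_eq_right (le_min zero_le_one h)]
      rcases le_total (s i) 1 with h' | h'
      · rw [min_eq_right h']; linarith
      · rw [min_eq_left h']; linarith
    · rw [min_eq_right (h.trans zero_le_one), max_eq_left h]; linarith
  · simp only [hk]
    rcases le_total 0 (s i) with h | h
    · rw [max_eq_right (le_min zero_le_one h)]
      rcases le_total (s i) 1 with h' | h'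
      · rw [min_eq_right h']; linarith
      · rw [min_eq_left h']; linarith
    · rw [min_eq_right (h.trans zero_le_one), max_eq_left h]; linarith

/-- **a uniform `δ`-box**: one `δ > 0` serving every region `X`. [cite: BalabanImbrieJaffe1988, p.305 (Sect. 5.13)] -/
theorem exists_box_subset_good_all (hΔ : Δ.PosDef) :
    ∃ δ : ℝ, 0 < δ ∧ ∀ (X : Finset I) (s : I → ℝ), (∀ i, -δ ≤ s i ∧ s i ≤ 1 + δ) → s ∈ good blk Δ X := by
  choose δf hδf hbox using fun X => exists_box_subset_good blk Δ hΔ X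
  refine ⟨Finset.univ.inf' Finset.univ_nonempty δf, (Finset.lt_inf'_iff _).2 fun X _ => hδf X, fun X s hs => hbox X s fun i => ?_⟩
  have hle : Finset.univ.inf' Finset.univ_nonempty δf ≤ δf X := Finset.inf'_le _ (Finset.mem_univ X)
  exact ⟨by linarith [(hs i).1], by linarith [(hs i).2]⟩

/-! ## §4 The squashed expectations: a family `D X Γ` satisfying p02's (global) FTC hypotheses -/

/-- the squashed expectation `Ẽ_X = ⟨Π f⟩_{Ψ(s),X}` (equal to `⟨Π f⟩_{s,X}` near the cube, smooth on all of `ℝ^I`).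
[cite: BalabanImbrieJaffe1988, (5.13.3) p.305] -/
def expectSq {δ : ℝ} (hδ : 0 < δ) (X : Finset I) (s : I → ℝ) : ℝ := BIJ88PolymerRep5134Gauss.expect blk Δ ℱ f X (Psi hδ s)

/-- `Ẽ_X` is `C^∞` on `ℝ^I` once the `δ`-box lies in `good X`. [cite: BalabanImbrieJaffe1988, (5.13.3) p.305] -/
theorem contDiff_expectSq (hfm : ∀ i, Measurable (f i)) (hfb : ∀ i, ∃ K, ∀ φ, |f i φ| ≤ K) (X : Finset I) {δ : ℝ} (hδ : 0 < δ)
    (hbox : ∀ s : I → ℝ, (∀ i, -δ ≤ s i ∧ s i ≤ 1 + δ) → s ∈ good blk Δ X) : ContDiff ℝ ∞ (expectSq blk Δ ℱ f hδ X) :=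
  (contDiffOn_expect blk Δ ℱ f hfm hfb X).comp_contDiff (contDiff_Psi hδ) fun s => hbox _ (Psi_mem hδ s)

/-- **the family `D X Γ = ∂_Γ Ẽ_X`** (iterated partials in the coordinate order of `L`). [cite: BalabanImbrieJaffe1988, (5.13.3) p.305] -/
def Dsq {δ : ℝ} (hδ : 0 < δ) (L : List I) (X Γ : Finset I) : (I → ℝ) → ℝ := pd (L.filter (· ∈ Γ)) (expectSq blk Δ ℱ f hδ X)

/-- **the honest family `∂_Γ⟨Π_{□_i⊂X} f(□_i)⟩_{s,X}`**: iterated partials of the expectation itself. [cite: BalabanImbrieJaffe1988, (5.13.3) p.305] -/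
def Dexp (L : List I) (X Γ : Finset I) : (I → ℝ) → ℝ := pd (L.filter (· ∈ Γ)) (BIJ88PolymerRep5134Gauss.expect blk Δ ℱ f X)

/-- `D X Γ` is continuous (p02's `hcont`). [cite: BalabanImbrieJaffe1988, (5.13.3) p.305] -/
theorem continuous_Dsq {δ : ℝ} {hδ : 0 < δ} {X : Finset I} (hsm : ContDiff ℝ ∞ (expectSq blk Δ ℱ f hδ X)) (L : List I)
    (Γ : Finset I) : Continuous (Dsq blk Δ ℱ f hδ L X Γ) :=
  (contDiff_pd hsm _).continuous

/-- **p02's `hderiv` for the family `D`**: `∂/∂s_k (D X Γ) = D X (Γ ∪ {k})` along every coordinate line (commuting partials).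
[cite: BalabanImbrieJaffe1988, (5.13.3) p.305] -/
theorem hasDerivAt_Dsq {δ : ℝ} {hδ : 0 < δ} {X : Finset I} (hsm : ContDiff ℝ ∞ (expectSq blk Δ ℱ f hδ X)) {L : List I} (hL : L.Nodup)
    {Γ : Finset I} {k : I} (hk : k ∈ L) (hkΓ : k ∉ Γ) (s : I → ℝ) :
    HasDerivAt (fun u => Dsq blk Δ ℱ f hδ L X Γ (update s k u)) (Dsq blk Δ ℱ f hδ L X (insert k Γ) s) (s k) := by
  obtain ⟨l₁, l₂, h1, h2⟩ := filter_insert_split hL hk hkΓ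
  have hD : Dsq blk Δ ℱ f hδ L X (insert k Γ) = fun s => fderiv ℝ (Dsq blk Δ ℱ f hδ L X Γ) s (Pi.single k 1) := by
    simp only [Dsq, h1, h2, pd_append, pd_cons]
    exact pd_dir_comm (contDiff_pd hsm l₂) (Pi.single k 1) l₁
  rw [hD]
  exact hasDerivAt_update_of_contDiff (contDiff_pd hsm _) s k

/-- at the corners `D X ∅ (1_Λ) = ⟨Π f⟩_{1_Λ,X} = zG X Λ` (`Ψ = id` on the cube). [cite: BalabanImbrieJaffe1988, (5.13.3) p.305] -/
theorem Dsq_empty_corner {δ : ℝ} (hδ : 0 < δ) (L : List I) (X Λ : Finset I) :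
    Dsq blk Δ ℱ f hδ L X ∅ (corner ℝ Λ) = zG blk Δ ℱ f X Λ := by
  have hfil : L.filter (· ∈ (∅ : Finset I)) = [] := by simp
  rw [Dsq, hfil, pd_nil, expectSq, zG, Psi_eq_self hδ]
  intro i
  simp only [corner]
  split_ifs <;> constructor <;> linarith

/-- no derivative: `Dexp X ∅ = ⟨Π_{□_i⊂X} f(□_i)⟩_{·,X}`. [cite: BalabanImbrieJaffe1988, (5.13.3) p.305] -/
theorem Dexp_empty (L : List I) (X : Finset I) : Dexp blk Δ ℱ f L X ∅ = BIJ88PolymerRep5134Gauss.expect blk Δ ℱ f X := by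
  have hfil : L.filter (· ∈ (∅ : Finset I)) = [] := by simp
  rw [Dexp, hfil, pd_nil]

/-- near a point of the cube the squashed family is the honest one. [cite: BalabanImbrieJaffe1988, (5.13.3) p.305] -/
theorem Dsq_eventuallyEq_Dexp {δ : ℝ} (hδ : 0 < δ) (L : List I) (X Γ : Finset I) {s : I → ℝ} (hs : ∀ i, 0 ≤ s i ∧ s i ≤ 1) :
    Dsq blk Δ ℱ f hδ L X Γ =ᶠ[𝓝 s] Dexp blk Δ ℱ f L X Γ := by
  have hev : expectSq blk Δ ℱ f hδ X =ᶠ[𝓝 s] BIJ88PolymerRep5134Gauss.expect blk Δ ℱ f X :=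
    (Psi_eventuallyEq_id hδ (fun i => ⟨by linarith [(hs i).1], by linarith [(hs i).2]⟩)).mono fun s' hs' => by
      simp only [expectSq, hs']
  exact pd_eventuallyEq _ hev

/-- **on the cube `D X Γ` IS the iterated partial of the expectation** (the squash is the identity near the cube).
[cite: BalabanImbrieJaffe1988, (5.13.3) p.305] -/
theorem Dsq_eq_Dexp_of_mem_cube {δ : ℝ} (hδ : 0 < δ) (L : List I) (X Γ : Finset I) {s : I → ℝ} (hs : ∀ i, 0 ≤ s i ∧ s i ≤ 1) :
    Dsq blk Δ ℱ f hδ L X Γ s = Dexp blk Δ ℱ f L X Γ s :=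
  (Dsq_eventuallyEq_Dexp blk Δ ℱ f hδ L X Γ hs).self_of_nhds

/-- **the honest partials satisfy the FTC recursion on the closed cube**: for `Δ ≻ 0`, bounded measurable `f(□_i)`, `s ∈ [0,1]^I`,
`k ∈ L ∖ Γ`: `d/du|_{u=s_k} ∂_Γ⟨Π f⟩_{s[k↦u],X} = ∂_{Γ∪{k}}⟨Π f⟩_{s,X}` (two-sided derivative, also at `s_k ∈ {0,1}`).
[cite: BalabanImbrieJaffe1988, (5.13.3) p.305] -/
theorem hasDerivAt_Dexp (hΔ : Δ.PosDef) (hfm : ∀ i, Measurable (f i)) (hfb : ∀ i, ∃ K, ∀ φ, |f i φ| ≤ K) {L : List I} (hL : L.Nodup)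
    (X : Finset I) {Γ : Finset I} {k : I} (hk : k ∈ L) (hkΓ : k ∉ Γ) {s : I → ℝ} (hs : ∀ i, 0 ≤ s i ∧ s i ≤ 1) :
    HasDerivAt (fun u => Dexp blk Δ ℱ f L X Γ (update s k u)) (Dexp blk Δ ℱ f L X (insert k Γ) s) (s k) := by
  obtain ⟨δ, hδ, hbox⟩ := exists_box_subset_good blk Δ hΔ X
  have hsm : ContDiff ℝ ∞ (expectSq blk Δ ℱ f hδ X) := contDiff_expectSq blk Δ ℱ f hfm hfb X hδ hbox
  have h := hasDerivAt_Dsq blk Δ ℱ f hsm hL hk hkΓ s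
  rw [Dsq_eq_Dexp_of_mem_cube blk Δ ℱ f hδ L X (insert k Γ) hs] at h
  refine h.congr_of_eventuallyEq ?_
  have ht : Tendsto (fun u : ℝ => update s k u) (𝓝 (s k)) (𝓝 s) := by
    have hc := (hasDerivAt_update s k (s k)).continuousAt
    rw [ContinuousAt, update_eq_self] at hc
    exact hc
  exact (ht.eventually (Dsq_eventuallyEq_Dexp blk Δ ℱ f hδ L X Γ hs)).mono fun u hu => hu.symm

/-- **THE p. 305 FTC EXPANSION, UNCONDITIONALLY, FOR THE GAUSSIAN EXPECTATIONS OF A REGION**: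
`⟨Π_{□_i⊂X} f(□_i)⟩_{1,X} = Σ_{Γ⊂I} ∫ds_Γ (∂/∂s_Γ)⟨Π_{□_i⊂X} f(□_i)⟩_{s_Γ,X}` (`s_i = 0` off `Γ`), with honest iterated partial derivatives —
p02's `BIJ88FTCExpansion305.ftc_expansion_univ` with its hypotheses discharged. [cite: BalabanImbrieJaffe1988, (5.13.3) p.305] -/
theorem ftc_expansion_gauss (hΔ : Δ.PosDef) (hfm : ∀ i, Measurable (f i)) (hfb : ∀ i, ∃ K, ∀ φ, |f i φ| ≤ K) (X : Finset I) :
    BIJ88PolymerRep5134Gauss.expect blk Δ ℱ f X (fun _ => 1)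
      = expansionSum (Finset.univ : Finset I).toList (Dexp blk Δ ℱ f (Finset.univ : Finset I).toList X) 0 := by
  obtain ⟨δ, hδ, hbox⟩ := exists_box_subset_good blk Δ hΔ X
  have hsm : ContDiff ℝ ∞ (expectSq blk Δ ℱ f hδ X) := contDiff_expectSq blk Δ ℱ f hfm hfb X hδ hbox
  have h := ftc_expansion_univ (Dsq blk Δ ℱ f hδ (Finset.univ : Finset I).toList X)
    (fun Γ => continuous_Dsq blk Δ ℱ f hsm _ Γ)
    (fun Γ k hkΓ s => hasDerivAt_Dsq blk Δ ℱ f hsm (Finset.nodup_toList _) (Finset.mem_toList.2 (Finset.mem_univ k)) hkΓ s)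
  have h0 : Dsq blk Δ ℱ f hδ (Finset.univ : Finset I).toList X ∅ (fun _ => 1) = BIJ88PolymerRep5134Gauss.expect blk Δ ℱ f X fun _ => 1 := by
    have hfil : (Finset.univ : Finset I).toList.filter (· ∈ (∅ : Finset I)) = [] := by simp
    rw [Dsq, hfil, pd_nil, expectSq, Psi_eq_self hδ]
    intro i
    constructor <;> linarith
  rw [← h0, h]
  exact expansionSum_congr_cube (fun Γ σ hσ => Dsq_eq_Dexp_of_mem_cube blk Δ ℱ f hδ _ X Γ hσ) _ fun _ => ⟨le_rfl, zero_le_one⟩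

variable (adj : I → I → Prop) [DecidableRel adj]

/-- the printed activities built from `D` equal those built from the honest partials `Dexp` (p02's `∫ds_Γ` only sees the cube).
[cite: BalabanImbrieJaffe1988, p.306 (Sect. 5.13)] -/
theorem g1Deriv_Dsq_eq {δ : ℝ} (hδ : 0 < δ) (L : List I) (X : Finset I) :
    g1Deriv adj L (Dsq blk Δ ℱ f hδ L) X = g1Deriv adj L (Dexp blk Δ ℱ f L) X := by
  unfold g1Deriv
  refine Finset.sum_congr rfl fun Γ _ => ?_
  exact iterInt_congr_cube (fun σ hσ => Dsq_eq_Dexp_of_mem_cube blk Δ ℱ f hδ L X Γ hσ) _ 0 fun _ => ⟨le_rfl, zero_le_one⟩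

/-- **DISPLAY (5.13.4), LEFT EQUALITY, WITH THE PRINTED DERIVATIVE-FORM ACTIVITIES, FOR THE GAUSSIAN MEASURES OF §5.13 —
UNCONDITIONALLY**: for `Δ ≻ 0` of range `≤ 1` in the cubes (`hΔr`), cube-local bounded measurable observables `f(□_i)`, any linear
term `ℱ`, and any duplicate-free coordinate list `L ⊇ W`:
`⟨Π_{i∈W} f(□_i)⟩_{1_W,W} = Σ_{{X_α} admissible filling of W} Π_α g₁(X_α)`,
`g₁(X) = Σ_{Γ⊆X: X a single cluster of Γ} ∫ds_Γ (∂/∂s_Γ)⟨Π_{□_i⊂X} f(□_i)⟩_{s_Γ,X}` — the `∂/∂s_Γ` being honest iterated partial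
derivatives (`Dexp`) of the Gaussian expectation, the `∫ds_Γ` p02's iterated unit-interval integrals (`BIJ88PolymerRep5134Deriv.g1Deriv`).
(The walk expansion (5.13.3) of the derivative is not reproduced.) [cite: BalabanImbrieJaffe1988, (5.13.4) p.306] -/
theorem polymerRep_deriv_gauss (hΔ : Δ.PosDef) (hΔr : ∀ x y, blk x ≠ blk y → ¬ adj (blk x) (blk y) → Δ x y = 0)
    (hf : ∀ i (φ ψ : α → ℝ), (∀ x, blk x = i → φ x = ψ x) → f i φ = f i ψ) (hfm : ∀ i, Measurable (f i))
    (hfb : ∀ i, ∃ K, ∀ φ, |f i φ| ≤ K) {L : List I} (hL : L.Nodup) {W : Finset I} (hW : W ⊆ L.toFinset) :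
    zG blk Δ ℱ f W W = ∑ P ∈ (setPartitions W).filter (IsAdmissible adj), ∏ X ∈ P, g1Deriv adj L (Dexp blk Δ ℱ f L) X := by
  obtain ⟨δ, hδ, hbox⟩ := exists_box_subset_good_all blk Δ hΔ
  have hsm : ∀ X : Finset I, ContDiff ℝ ∞ (expectSq blk Δ ℱ f hδ X) := fun X =>
    contDiff_expectSq blk Δ ℱ f hfm hfb X hδ (hbox X)
  have hcorner : (fun X Λ => Dsq blk Δ ℱ f hδ L X ∅ (corner ℝ Λ)) = zG blk Δ ℱ f := by
    funext X Λ
    exact Dsq_empty_corner blk Δ ℱ f hδ L X Λ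
  have hz : IsClusterFactorizing adj (fun X Λ => Dsq blk Δ ℱ f hδ L X ∅ (corner ℝ Λ)) := by
    rw [hcorner]
    exact isClusterFactorizing_zG blk Δ ℱ f adj hΔr hf
  have h := polymerRep_deriv adj hL (Dsq blk Δ ℱ f hδ L) hW (fun X _ Γ => continuous_Dsq blk Δ ℱ f (hsm X) L Γ)
    (fun X _ Γ k hk hkΓ s => hasDerivAt_Dsq blk Δ ℱ f (hsm X) hL hk hkΓ s) hz
  rw [Dsq_empty_corner blk Δ ℱ f hδ L W W] at h
  rw [h]
  exact Finset.sum_congr rfl fun P _ => Finset.prod_congr rfl fun X _ => g1Deriv_Dsq_eq blk Δ ℱ f adj hδ L X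

/-- the same with the un-interpolated left side made explicit: at `s = 1_W` the `W`-precision is the `W`-block of `Δ`
(`BIJ88PolymerRep5134Gauss.prec_ind_self`), i.e. the left side is `⟨Π_{i∈W} f(□_i)⟩_1` over the fields of `W`, and with
`L = univ.toList`. [cite: BalabanImbrieJaffe1988, (5.13.4) p.306] -/
theorem polymerRep_deriv_gauss_univ (hΔ : Δ.PosDef) (hΔr : ∀ x y, blk x ≠ blk y → ¬ adj (blk x) (blk y) → Δ x y = 0)
    (hf : ∀ i (φ ψ : α → ℝ), (∀ x, blk x = i → φ x = ψ x) → f i φ = f i ψ) (hfm : ∀ i, Measurable (f i))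
    (hfb : ∀ i, ∃ K, ∀ φ, |f i φ| ≤ K) (W : Finset I) :
    BIJ88PolymerRep5134Gauss.expect blk Δ ℱ f W (corner ℝ W)
      = ∑ P ∈ (setPartitions W).filter (IsAdmissible adj), ∏ X ∈ P,
          g1Deriv adj (Finset.univ : Finset I).toList (Dexp blk Δ ℱ f (Finset.univ : Finset I).toList) X :=
  polymerRep_deriv_gauss blk Δ ℱ f adj hΔ hΔr hf hfm hfb (Finset.nodup_toList _) fun i _ => by simp

end Model

end Literature.MathematicalPhysics.QuantumFieldTheory.BalabanImbrieJaffe1984to88.BIJ88PolymerRep5134DerivGauss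

end
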